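import Summits.AtomisticToContinuum.HydrodynamicLimit.Theses.LoschmidtIsentropicSelection
import Literature.Probability.Entropy.EntropyInequality

/-!
# Birth skeleton for the piece `LocalGibbsExpConcentration` (child 2 of the split of `AutonomousClosure`)
Stubs 4–5 of the line `entropy-seam` and the composition `localGibbsExpConcentration_of` concluding the piece's statement
VERBATIM (publish as `Cruxes/LocalGibbsExpConcentration/Lines/birth.lean` once the decl exists). lean check: rc 0,
sorries = 2 = stubs.
-/

namespace Summit.AtomisticToContinuum.HydrodynamicLimit.Cruxes.AutonomousClosure.EntropySeam

open MeasureTheory Filter Set Topology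
open scoped ENNReal

/-- Stub 4 (statics): exponential concentration (large-deviation upper bound) of the empirical DENSITY field of a dilute
local Gibbs law around its law-of-large-numbers limit (canonical cluster expansion of the tilted partition function,
Ruelle 1969 Ch. 4; Georgii–Zessin 1993 for the grand-canonical LDP). [cite: GeorgiiZessin1993, Thm 3.1] -/
theorem stub_densityLDP :
    ∃ η₀ : ℝ, 0 < η₀ ∧ ∀ σ : ℝ, 0 < σ → ∀ (a θ ρV : Literature.MathematicalPhysics.KineticTheory.T3 → ℝ) (u : Literature.MathematicalPhysics.KineticTheory.T3 → Literature.MathematicalPhysics.KineticTheory.V3), Continuous a → Continuous θ → Continuous ρV → Continuous u → (∀ x, 0 < a x) → (∀ x, 0 < θ x) → (∀ x, 0 < ρV x) → (∀ x, ρV x * σ ^ 3 < η₀) → ∀ Φ : (N : ℕ) → Literature.Analysis.FluidPDE.HardSphereFlow (Literature.Analysis.FluidPDE.Torus.geometry (Fin 3)) (Literature.MathematicalPhysics.KineticTheory.hsDiameter σ N) (N + 1), (∀ N, MeasureTheory.IsProbabilityMeasure (Literature.MathematicalPhysics.KineticTheory.localGibbsLaw σ a u θ N (Φ N))) → Literature.MathematicalPhysics.KineticTheory.TendstoHydroFieldsAt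 (fun N => Literature.MathematicalPhysics.KineticTheory.localGibbsLaw σ a u θ N (Φ N)) Φ (fun _ => ρV) (fun _ => u) (fun _ => θ) 0 → ∀ χ : Literature.MathematicalPhysics.KineticTheory.T3 → ℝ, Continuous χ → ∀ δ : ℝ, 0 < δ → ∃ C : ℝ, 0 < C ∧ ∀ N : ℕ, Literature.MathematicalPhysics.KineticTheory.localGibbsLaw σ a u θ N (Φ N) {z | δ < |Literature.MathematicalPhysics.KineticTheory.empiricalDensityField z χ - ∫ x, χ x * ρV x|} ≤ ENNReal.ofReal (C * Real.exp (-(C⁻¹ * (N + 1)))) := by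
  sorry

/-- Stub 5 (statics): conditionally on the positions the velocities of a local Gibbs law are independent Maxwellians
`M_{u(x_i), θ(x_i)}`, so exponential concentration of the density field (for all continuous test functions) upgrades to
exponential concentration of the momentum and energy fields (Cramér–Chernoff / Bernstein bounds; Kipnis–Landim 1999
App. 1). [cite: KipnisLandim1999, Appendix 1 Prop. 8.2] -/
theorem stub_maxwellianMarks :
    ∀ σ : ℝ, 0 < σ → ∀ (a θ ρV : Literature.MathematicalPhysics.KineticTheory.T3 → ℝ) (u : Literature.MathematicalPhysics.KineticTheory.T3 → Literature.MathematicalPhysics.KineticTheory.V3), Continuous a → Continuous θ → Continuous ρV → Continuous u → (∀ x, 0 < a x) → (∀ x, 0 < θ x) → ∀ Φ : (N : ℕ) → Literature.Analysis.FluidPDE.HardSphereFlow (Literature.Analysis.FluidPDE.Torus.geometry (Fin 3)) (Literature.MathematicalPhysics.KineticTheory.hsDiameter σ N) (N + 1), (∀ N, MeasureTheory.IsProbabilityMeasure (Literature.MathematicalPhysics.KineticTheory.localGibbsLaw σ a u θ N (Φ N))) → (∀ χ : Literature.MathematicalPhysics.KineticTheory.T3 → ℝ, Continuous χ → ∀ δ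 : ℝ, 0 < δ → ∃ C : ℝ, 0 < C ∧ ∀ N : ℕ, Literature.MathematicalPhysics.KineticTheory.localGibbsLaw σ a u θ N (Φ N) {z | δ < |Literature.MathematicalPhysics.KineticTheory.empiricalDensityField z χ - ∫ x, χ x * ρV x|} ≤ ENNReal.ofReal (C * Real.exp (-(C⁻¹ * (N + 1))))) → ∀ χ : Literature.MathematicalPhysics.KineticTheory.T3 → ℝ, Continuous χ → ∀ δ : ℝ, 0 < δ → ∃ C : ℝ, 0 < C ∧ ∀ N : ℕ, Literature.MathematicalPhysics.KineticTheory.localGibbsLaw σ a u θ N (Φ N) {z | δ < ‖Literature.MathematicalPhysics.KineticTheory.empiricalMomentumField z χ - ∫ x, (χ x * ρV x) • u x‖} ≤ ENNReal.ofReal (C * Real.exp (-(C⁻¹ * (N + 1)))) ∧ Literature.MathematicalPhysics.KineticTheory.localGibbsLaw σ a u θ N (Φ N) {z | δ < |Literature.MathematicalPhysics.KineticTheory.empiricalEnergyField z χ - ∫ x, χ x * Literature.MathematicalPhysics.KineticTheory.totalEnergyDensity (ρV x) (u x) (θ x)|} ≤ ENNReal.ofReal (C * Real.exp (-(C⁻¹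 * (N + 1)))) := by
  sorry

/-- Monotonicity of the exponential budget `C ↦ C e^{-(N+1)/C}`. [folklore] -/
theorem expBudget_mono {C₁ C : ℝ} (hC₁ : 0 < C₁) (h : C₁ ≤ C) (N : ℕ) :
    ENNReal.ofReal (C₁ * Real.exp (-(C₁⁻¹ * (N + 1)))) ≤ ENNReal.ofReal (C * Real.exp (-(C⁻¹ * (N + 1)))) := by
  apply ENNReal.ofReal_le_ofReal
  have hC : 0 < C := hC₁.trans_le h
  apply mul_le_mul h _ (Real.exp_pos _).le hC.le
  apply Real.exp_le_exp.mpr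
  have hn : (0 : ℝ) ≤ (N : ℝ) + 1 := by positivity
  have hinv : C⁻¹ ≤ C₁⁻¹ := inv_anti₀ hC₁ h
  nlinarith [mul_le_mul_of_nonneg_right hinv hn]

/-- Child 2 of the split from stubs 4–5: `LocalGibbsExpConcentration` (statement verbatim), with `C := max C₁ C₂`.
[cite: KipnisLandim1999, Appendix 1 Prop. 8.2] -/
theorem localGibbsExpConcentration_of
    (h4 : ∃ η₀ : ℝ, 0 < η₀ ∧ ∀ σ : ℝ, 0 < σ → ∀ (a θ ρV : Literature.MathematicalPhysics.KineticTheory.T3 → ℝ) (u : Literature.MathematicalPhysics.KineticTheory.T3 → Literature.MathematicalPhysics.KineticTheory.V3), Continuous a → Continuous θ → Continuous ρV → Continuous u → (∀ x, 0 < a x) → (∀ x, 0 < θ x) → (∀ x, 0 < ρV x) → (∀ x, ρV x * σ ^ 3 < η₀) → ∀ Φ : (N : ℕ) → Literature.Analysis.FluidPDE.HardSphereFlow (Literature.Analysis.FluidPDE.Torus.geometry (Fin 3)) (Literature.MathematicalPhysics.KineticTheory.hsDiameter σ N) (N + 1), (∀ N, MeasureTheory.IsProbabilityMeasure (Literature.MathematicalPhysics.KineticTheory.localGibbsLaw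 σ a u θ N (Φ N))) → Literature.MathematicalPhysics.KineticTheory.TendstoHydroFieldsAt (fun N => Literature.MathematicalPhysics.KineticTheory.localGibbsLaw σ a u θ N (Φ N)) Φ (fun _ => ρV) (fun _ => u) (fun _ => θ) 0 → ∀ χ : Literature.MathematicalPhysics.KineticTheory.T3 → ℝ, Continuous χ → ∀ δ : ℝ, 0 < δ → ∃ C : ℝ, 0 < C ∧ ∀ N : ℕ, Literature.MathematicalPhysics.KineticTheory.localGibbsLaw σ a u θ N (Φ N) {z | δ < |Literature.MathematicalPhysics.KineticTheory.empiricalDensityField z χ - ∫ x, χ x * ρV x|} ≤ ENNReal.ofReal (C * Real.exp (-(C⁻¹ * (N + 1)))))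
    (h5 : ∀ σ : ℝ, 0 < σ → ∀ (a θ ρV : Literature.MathematicalPhysics.KineticTheory.T3 → ℝ) (u : Literature.MathematicalPhysics.KineticTheory.T3 → Literature.MathematicalPhysics.KineticTheory.V3), Continuous a → Continuous θ → Continuous ρV → Continuous u → (∀ x, 0 < a x) → (∀ x, 0 < θ x) → ∀ Φ : (N : ℕ) → Literature.Analysis.FluidPDE.HardSphereFlow (Literature.Analysis.FluidPDE.Torus.geometry (Fin 3)) (Literature.MathematicalPhysics.KineticTheory.hsDiameter σ N) (N + 1), (∀ N, MeasureTheory.IsProbabilityMeasure (Literature.MathematicalPhysics.KineticTheory.localGibbsLaw σ a u θ N (Φ N))) → (∀ χ : Literature.MathematicalPhysics.KineticTheory.T3 → ℝ, Continuous χ → ∀ δ : ℝ, 0 < δ → ∃ C : ℝ, 0 < C ∧ ∀ N : ℕ, Literature.MathematicalPhysics.KineticTheory.localGibbsLaw σ a u θ N (Φ N) {z | δ < |Literature.MathematicalPhysics.KineticTheory.empiricalDensityField z χ - ∫ x, χ x * ρV x|} ≤ ENNReal.ofReal (C * Real.exp (-(C⁻¹ * (N + 1))))) → ∀ χ : Literature.MathematicalPhysics.KineticTheory.T3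 → ℝ, Continuous χ → ∀ δ : ℝ, 0 < δ → ∃ C : ℝ, 0 < C ∧ ∀ N : ℕ, Literature.MathematicalPhysics.KineticTheory.localGibbsLaw σ a u θ N (Φ N) {z | δ < ‖Literature.MathematicalPhysics.KineticTheory.empiricalMomentumField z χ - ∫ x, (χ x * ρV x) • u x‖} ≤ ENNReal.ofReal (C * Real.exp (-(C⁻¹ * (N + 1)))) ∧ Literature.MathematicalPhysics.KineticTheory.localGibbsLaw σ a u θ N (Φ N) {z | δ < |Literature.MathematicalPhysics.KineticTheory.empiricalEnergyField z χ - ∫ x, χ x * Literature.MathematicalPhysics.KineticTheory.totalEnergyDensity (ρV x) (u x) (θ x)|} ≤ ENNReal.ofReal (C * Real.exp (-(C⁻¹ * (N + 1))))) :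
    ∃ η₀ : ℝ, 0 < η₀ ∧ ∀ σ : ℝ, 0 < σ → ∀ (a θ ρV : Literature.MathematicalPhysics.KineticTheory.T3 → ℝ) (u : Literature.MathematicalPhysics.KineticTheory.T3 → Literature.MathematicalPhysics.KineticTheory.V3), Continuous a → Continuous θ → Continuous ρV → Continuous u → (∀ x, 0 < a x) → (∀ x, 0 < θ x) → (∀ x, 0 < ρV x) → (∀ x, ρV x * σ ^ 3 < η₀) → ∀ Φ : (N : ℕ) → Literature.Analysis.FluidPDE.HardSphereFlow (Literature.Analysis.FluidPDE.Torus.geometry (Fin 3)) (Literature.MathematicalPhysics.KineticTheory.hsDiameter σ N) (N + 1), (∀ N, MeasureTheory.IsProbabilityMeasure (Literature.MathematicalPhysics.KineticTheory.localGibbsLaw σ a u θ N (Φ N))) → Literature.MathematicalPhysics.KineticTheory.TendstoHydroFieldsAt (fun N => Literature.MathematicalPhysics.KineticTheory.localGibbsLaw σ a u θ N (Φ N)) Φ (fun _ => ρV) (fun _ => u) (fun _ => θ) 0 → ∀ χ : Literature.MathematicalPhysics.KineticTheory.T3 → ℝ, Continuous χ → ∀ δ : ℝ, 0 < δ → ∃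 C : ℝ, 0 < C ∧ ∀ N : ℕ, Literature.MathematicalPhysics.KineticTheory.localGibbsLaw σ a u θ N (Φ N) {z | δ < |Literature.MathematicalPhysics.KineticTheory.empiricalDensityField z χ - ∫ x, χ x * ρV x|} ≤ ENNReal.ofReal (C * Real.exp (-(C⁻¹ * (N + 1)))) ∧ Literature.MathematicalPhysics.KineticTheory.localGibbsLaw σ a u θ N (Φ N) {z | δ < ‖Literature.MathematicalPhysics.KineticTheory.empiricalMomentumField z χ - ∫ x, (χ x * ρV x) • u x‖} ≤ ENNReal.ofReal (C * Real.exp (-(C⁻¹ * (N + 1)))) ∧ Literature.MathematicalPhysics.KineticTheory.localGibbsLaw σ a u θ N (Φ N) {z | δ < |Literature.MathematicalPhysics.KineticTheory.empiricalEnergyField z χ - ∫ x, χ x * Literature.MathematicalPhysics.KineticTheory.totalEnergyDensity (ρV x) (u x) (θ x)|} ≤ ENNReal.ofReal (C * Real.exp (-(C⁻¹ * (N + 1)))) := by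
  obtain ⟨η₀, hη₀, H4⟩ := h4
  refine ⟨η₀, hη₀, fun σ hσ a θ ρV u ha hθ hρ hu ha0 hθ0 hρ0 hguard Φ hprob hlln χ hχ δ hδ => ?_⟩
  have hdens := H4 σ hσ a θ ρV u ha hθ hρ hu ha0 hθ0 hρ0 hguard Φ hprob hlln
  obtain ⟨C₁, hC₁, h1⟩ := hdens χ hχ δ hδ
  obtain ⟨C₂, hC₂, h2⟩ := h5 σ hσ a θ ρV u ha hθ hρ hu ha0 hθ0 Φ hprob hdens χ hχ δ hδ
  refine ⟨max C₁ C₂, lt_max_of_lt_left hC₁, fun N => ⟨?_, ?_, ?_⟩⟩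
  · exact (h1 N).trans (expBudget_mono hC₁ (le_max_left _ _) N)
  · exact (h2 N).1.trans (expBudget_mono hC₂ (le_max_right _ _) N)
  · exact (h2 N).2.trans (expBudget_mono hC₂ (le_max_right _ _) N)

end Summit.AtomisticToContinuum.HydrodynamicLimit.Cruxes.AutonomousClosure.EntropySeam
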